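import Literature.AnabelianGeometry.EtaleTheta.KummerContainerZHatTwist
import Literature.AnabelianGeometry.EtaleTheta.KummerMapExactness
import Literature.AnabelianGeometry.EtaleTheta.KummerComparison
import Literature.AnabelianGeometry.EtaleTheta.ZHatLevelDetermination
import HarnessLib

/-!
# Kummer container bricks: the kernel of the level-`N` Kummer class, twists versus levels, and unique roots in `Ẑ`

Sources.  Level-`N` Kummer classes: S. Mochizuki, *The geometry of Frobenioids II*, Def. 2.1 (ii), p. 16
[cite: MochizukiFrdII2008, Def 2.1 (ii) p.16] (tree: `Kummer.kummerClassOfRoot` / `Kummer.kummerClass`,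
`Frobenioids/KummerClass.lean`).  The container `lim_{→ H} H¹(H, Λ(A))`, its Kummer map and level projections: LANA
Project interim report [LANA2026Report], §6.1 pp. 31–32 (tree: `H1Colimit`, `toColimit`, `kummerMap`, `H1ToLevel`,
`cyclotome.toMu`).  `Ẑ^× = Aut(Ẑ)` and its level characters `χ_n`: [cite: RibesZalesskii2010, Thm 2.7.1] (tree:
`cyclotome.zhatTwist`, `H1Twist`, `ZHatLevel.levelChar`, `ZHatLevel.level`, `ZHatLevel.ext_of_level`).

PROOF-ONLY bricks (abc-iut cell, L2 Kummer lane vocabulary; classical).  No definition, no instance, no named fact.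
Written while serving GAP-LEDGER row G-w4d057g4-1 (law (V) of [IUTchI] Ex. 5.1 (v)); THAT LAW ITSELF is abc-iut-w4-d057's
`KummerContainerValuationTransport.lean` (p433474: `exists_level_forall_pow_eq_of_H1ColimTwist_kummerMap_eq`,
`valuationTransport_law`, …) and is cited BY NAME, not restated here.  What this file adds is disjoint from it:

* `exists_fixed_root_of_levelKummerClass_eq_zero` (`'`) — **the kernel of the [FrdII] level-`N` Kummer class**: in the
  setting of Def. 2.1 (ii) (commutative cancellative monoid `O` with a `Γ`-action, `N`-th roots differing by units),
  `κ_f = 0` in `H¹(H, μ_N(O))` forces an `H`-INVARIANT `N`-th root of `f` (the coboundary `ξ ∈ μ_N` of the cocycle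
  `h ↦ ζ_h` gives the root `ξ⁻¹ g`).  The elementary inclusion `ker ⊆ (O^H)^N` of Kummer theory — no Hilbert 90.
  (The `Λ`-adic analogue is `kummerClass_eq_zero_iff`, `KummerKernel.lean`.)
* `toMu_zhatTwist`, `H1ToLevel_H1Twist` — **twists project to powers**: the level-`n` projection of the `Ẑ^×`-twist is
  multiplication by the level character, `toMu n (u · ζ) = (toMu n ζ)^{χ_n(u)}` and
  `H1ToLevel n ∘ H1Twist u = χ_n(u) • H1ToLevel n` on `H¹(H, Λ(A)) → H¹(H, μ_n(A))` — the bridge between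
  `KummerContainerZHatTwist.lean` (the `Ẑ^×`-module structure) and `KummerComparison.lean` (the level projections).
* `exists_resH1_eq_of_toColimit_eq` — equaliser form of the exactness of Mathlib's `AddCommGroup.DirectLimit` for the
  system `i ↦ H¹(S i, Λ(A))`: two level-`i` classes with the same image in the container agree at some deeper level.
* `zhat_eq_of_pow_eq_pow` — **`Ẑ` has unique `e`-th roots** (`e ≥ 1`): `z^e = z'^e ⇒ z = z'` (levels `n·e` and
  `ZHatLevel.cast_level_mul`); e.g. to strip a ramification index from a relation between level valuations.

HONEST FRAMING: classical algebra, OUR kernel check; nothing here bears on [IUTchIII] Cor. 3.12 or asserts any statement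
of the disputed series.  Groups in `Type` (Mathlib `groupCohomology` is single-universe), as in the landed Kummer files.
-/

noncomputable section

namespace Literature.AnabelianGeometry.EtaleTheta

open groupCohomology CategoryTheory ProfiniteGrp ProfiniteGrp.ProfiniteCompletion
open Literature.AlgebraicGeometry.Frobenioids

/-! ## 1. The kernel of the level-`N` Kummer class ([FrdII] Def. 2.1 (ii)) -/

section LevelKernel

variable {Γ : Type} [Group Γ] {N : ℕ} {O : Type} [CommMonoid O] [MulDistribMulAction Γ O]
  [IsCancelMul O] (hO : Kummer.NthRootsDifferByUnits N O) (H : Subgroup Γ)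

/-- **Kernel of the level-`N` Kummer class.**  In the setting of [FrdII] Def. 2.1 (ii) (a commutative
cancellative monoid `O` with a `Γ`-action in which two `N`-th roots of an element differ by a unit), if the Kummer
class `κ_f ∈ H¹(H, μ_N(O))` of the `H`-invariant `f`, computed from an `N`-th root `g`, VANISHES, then `f` admits an
`H`-INVARIANT `N`-th root: the cocycle `h ↦ ζ_h` (`h • g = ζ_h g`) is the coboundary of some `ξ ∈ μ_N`, and
`ξ⁻¹ · g` is the invariant root.  [The elementary inclusion `ker ⊆ (O^H)^N` of Kummer theory.]
[cite: MochizukiFrdII2008, Def 2.1 (ii) p.16] -/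
theorem exists_fixed_root_of_levelKummerClass_eq_zero {f g : O} (hg : g ^ N = f)
    (hf : ∀ h : H, (h : Γ) • f = f) (h0 : Kummer.kummerClassOfRoot hO H hg hf = 0) :
    ∃ g' : O, (∀ h : H, (h : Γ) • g' = g') ∧ g' ^ N = f := by
  obtain ⟨ξ, hξ⟩ := isMulCoboundary₁_of_mem_coboundaries₁ _ ((H1π_eq_zero_iff _).1 h0)
  refine ⟨((ξ.val⁻¹ : Oˣ) : O) * g, fun h => ?_, ?_⟩
  · -- the coboundary identity `h • ξ / ξ = ζ_h`, read on the underlying units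
    have e : (h : Γ) • ξ / ξ = Kummer.kummerCocycle hO H hg hf h := hξ h
    have hu : Kummer.unitsAct (h : Γ) ξ.val * ξ.val⁻¹ = (Kummer.kummerCocycle hO H hg hf h).val := by
      have e' := congrArg Kummer.Mu.val e
      rwa [div_eq_mul_inv, Kummer.Mu.val_mul, Kummer.Mu.val_inv, Kummer.Mu.val_smul] at e'
    rw [MulDistribMulAction.smul_mul, Kummer.smul_root_eq hO H hg hf h, ← hu, ← Kummer.coe_unitsAct,
      ← mul_assoc, ← Units.val_mul, map_inv, inv_mul_cancel_left]
  · have hξN : ξ.val ^ N = 1 := (mem_rootsOfUnity N ξ.val).1 ξ.val_mem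
    rw [mul_pow, hg, ← Units.val_pow_eq_pow_val, inv_pow, hξN, inv_one, Units.val_one, one_mul]

/-- The same for the bundled [FrdII] Kummer class `Kummer.kummerClass` on the Kummer domain
`O^H ∩ O^N`: `κ_f = 0` ⇒ `f` has an `H`-invariant `N`-th root. [cite: MochizukiFrdII2008, Def 2.1 (ii) p.16] -/
theorem exists_fixed_root_of_levelKummerClass_eq_zero' (f : Kummer.kummerDomain N O H)
    (h0 : Kummer.kummerClass hO H f = 0) :
    ∃ g' : O, (∀ h : H, (h : Γ) • g' = g') ∧ g' ^ N = (f : O) := by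
  obtain ⟨g, hg⟩ := f.2.2
  rw [Kummer.kummerClass_eq hO H f hg] at h0
  exact exists_fixed_root_of_levelKummerClass_eq_zero hO H hg f.2.1 h0

end LevelKernel

/-! ## 2. Twists project to powers: `H1ToLevel ∘ H1Twist u = χ_n(u) • H1ToLevel` -/

section TwistLevel

variable {N : ℕ} {O : Type} [CommMonoid O]

/-- Underlying unit of a power in `μ_N`. [cite: MochizukiFrdII2008, Def 2.1 (i) p.16] -/
theorem mu_val_pow (ζ : Kummer.Mu N O) (k : ℕ) : (ζ ^ k).val = ζ.val ^ k := by
  induction k with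
  | zero => rw [pow_zero, pow_zero, Kummer.Mu.val_one]
  | succ k ih => rw [pow_succ, pow_succ, Kummer.Mu.val_mul, ih]

variable {G : Type} [Group G] {A : Type} [CommGroup A] [MulDistribMulAction G A] (H : Subgroup G)

/-- **The twist by `u ∈ Ẑ^×` projects to the `χ_n(u)`-th power map on `μ_n(A)`**: `(u · ζ)_n = ζ_n ^ χ_n(u)`
(`cyclotome.zhatTwist_apply_coe`) read through the level-`n` projection `toMu`. [cite: RibesZalesskii2010, Thm 2.7.1] -/
theorem toMu_zhatTwist (n : ℕ+) (u : MulAut (completion (GrpCat.of (Multiplicative ℤ)))) (ζ : cyclotome A) :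
    cyclotome.toMu n (cyclotome.zhatTwist A u ζ) = cyclotome.toMu n ζ ^ (ZHatLevel.levelChar n u).val :=
  Kummer.Mu.ext (Units.ext (by
    rw [cyclotome.coe_val_toMu, cyclotome.zhatTwist_apply_coe, mu_val_pow, Units.val_pow_eq_pow_val,
      cyclotome.coe_val_toMu]))

/-- **Twists project to powers on `H¹`.**  For a class `c ∈ H¹(H, Λ(A))` and `u ∈ Ẑ^× = Aut(Ẑ)`, the level-`n`
image of the twisted class `u · c` is `χ_n(u)` times the level-`n` image of `c`:
`H1ToLevel n (H1Twist u c) = χ_n(u) • H1ToLevel n c` in `H¹(H, μ_n(A))` (checked on cocycles: both are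
`h ↦ (c(h))_n ^ χ_n(u)`). [cite: LANA2026Report, §6.1 p.31] -/
theorem H1ToLevel_H1Twist (n : ℕ+) (u : MulAut (completion (GrpCat.of (Multiplicative ℤ))))
    (c : H1 (cyclotomeRep (A := A) H)) :
    H1ToLevel H n (H1Twist (A := A) H u c) = (ZHatLevel.levelChar n u).val • H1ToLevel H n c := by
  induction c using H1_induction_on with
  | h x =>
    rw [H1Twist, H1ToLevel, H1π_comp_map_apply, H1π_comp_map_apply, H1π_comp_map_apply, ← map_nsmul]
    congr 1
    refine cocycles₁_ext fun h => ?_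
    rw [coe_mapCocycles₁, coe_mapCocycles₁]
    change (cyclotomeRepToMu H n).hom ((cyclotomeRepTwist (A := A) H u).hom (x h)) =
      (ZHatLevel.levelChar n u).val • (cyclotomeRepToMu H n).hom (x h)
    rw [cyclotomeRepTwist_hom_apply, cyclotomeRepToMu_hom_apply, cyclotomeRepToMu_hom_apply, toMul_ofMul,
      toMu_zhatTwist]
    exact ofMul_pow _ _

end TwistLevel

/-! ## 3. From the container back to a level -/

section ColimitLevel

variable {G : Type} [Group G] {A : Type} [CommGroup A] [MulDistribMulAction G A]
  {ι : Type} [Preorder ι] [DecidableEq ι] [IsDirectedOrder ι] (S : ι → Subgroup G)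
  (hS : ∀ ⦃i j : ι⦄, i ≤ j → S j ≤ S i)

/-- **Equality in the container is equality at some level.**  If two classes of `H¹(S i, Λ(A))` have the same image
in `lim_{→} H¹(S ·, Λ(A))`, they agree after restriction to some `S j ≤ S i` (exactness of the direct limit,
`AddCommGroup.DirectLimit.of.zero_exact`, for the directed system `directedSystem_H1System`).
[cite: LANA2026Report, §6.1 p.31] -/
theorem exists_resH1_eq_of_toColimit_eq {i : ι} (c c' : H1 (cyclotomeRep (A := A) (S i)))
    (h : toColimit S hS i c = toColimit S hS i c') :
    ∃ (j : ι) (hij : i ≤ j), resH1 (hS hij) c = resH1 (hS hij) c' := by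
  haveI := directedSystem_H1System (A := A) S hS
  have h0 : toColimit S hS i (c - c') = 0 := by rw [map_sub, h, sub_self]
  obtain ⟨j, hij, hj⟩ :=
    AddCommGroup.DirectLimit.of.zero_exact (f := H1System (A := A) S hS) i (c - c') h0
  refine ⟨j, hij, ?_⟩
  rw [map_sub, sub_eq_zero] at hj
  exact hj

end ColimitLevel

/-! ## 4. `Ẑ` has unique `e`-th roots -/

section ZHatRoots

/-- **`Ẑ` has unique `e`-th roots** (`e ≥ 1`): `z ^ e = z' ^ e ⇒ z = z'` — at level `n·e` the class of `t := z/z'`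
is killed by `e`, so its reduction mod `n` vanishes (`ZHatLevel.cast_level_mul`), and elements of `Ẑ` are determined
by their levels (`ZHatLevel.ext_of_level`).  [E.g. `u(η(e·d)) = η(e·d′) ⇒ u(η d) = η d′`: strip a ramification index `e`
from a relation between level valuations; cf. `ZHatLevel.apply_eta_eq_eta_of_forall_dvd`.] [cite: RibesZalesskii2010, Thm 2.7.1] -/
theorem zhat_eq_of_pow_eq_pow {z z' : completion (GrpCat.of (Multiplicative ℤ))} {e : ℕ} (he : 0 < e)
    (h : z ^ e = z' ^ e) : z = z' := by
  refine ZHatLevel.ext_of_level fun n => ?_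
  let m : ℕ+ := ⟨e, he⟩
  haveI : NeZero ((n * m : ℕ+) : ℕ) := ⟨(n * m).ne_zero⟩
  haveI : NeZero (n : ℕ) := ⟨n.ne_zero⟩
  -- `δ := level_{ne}(z) − level_{ne}(z')` is killed by `e` in `ℤ/(ne)`
  have h2 : ((e : ℕ) : ZMod ((n * m : ℕ+) : ℕ)) *
      (Multiplicative.toAdd (ZHatLevel.level (n * m) z) - Multiplicative.toAdd (ZHatLevel.level (n * m) z')) = 0 := by
    have h1 := congrArg (fun s => Multiplicative.toAdd (ZHatLevel.level (n * m) s)) h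
    simp only [map_pow, toAdd_pow, nsmul_eq_mul] at h1
    rw [mul_sub, h1, sub_self]
  -- hence `n` divides the representative of `δ`
  have h4 : ((n * m : ℕ+) : ℕ) ∣ e *
      (Multiplicative.toAdd (ZHatLevel.level (n * m) z) - Multiplicative.toAdd (ZHatLevel.level (n * m) z')).val := by
    apply (ZMod.natCast_eq_zero_iff _ _).1
    rw [Nat.cast_mul, ZMod.natCast_zmod_val]
    exact h2
  have h3 : (n : ℕ) ∣
      (Multiplicative.toAdd (ZHatLevel.level (n * m) z) - Multiplicative.toAdd (ZHatLevel.level (n * m) z')).val := by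
    have h5 : e * (n : ℕ) ∣ e *
        (Multiplicative.toAdd (ZHatLevel.level (n * m) z) - Multiplicative.toAdd (ZHatLevel.level (n * m) z')).val :=
      dvd_trans (dvd_of_eq (by rw [PNat.mul_coe, mul_comm]; rfl)) h4
    exact (mul_dvd_mul_iff_left he.ne').1 h5
  -- so the two level-`n` values agree
  apply Multiplicative.toAdd.injective
  rw [← ZHatLevel.cast_level_mul n m z, ← ZHatLevel.cast_level_mul n m z', ← sub_eq_zero, ← map_sub,
    ZMod.castHom_apply, ZMod.cast_eq_val]
  exact (ZMod.natCast_eq_zero_iff _ _).2 h3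

end ZHatRoots

end Literature.AnabelianGeometry.EtaleTheta

end
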